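import Mathlib

/-!
# Tier7/Line3/UnitaryOneOneCentre — `U(1,1) = U(1) · SU(1,1)` and the diagonal torus `= Z · K` (seat t7-x1, gen 2;
the t7-lead's RESIDUAL MAP row U1, matrix half, STATUS l. 15242)

LINE 3 (t7-plan-3), version (ii), the archimedean factor at a rank-one place (memo §2f row (3) [W]): the real group
`U(W_A)(F_{ι_j}) ≅ U(1,1)` and p1's model group `SU(1,1)`. This module is the matrix bookkeeping of the reduction,
over `ℂ` with `J = diag(1, −1)`:
* `IsU11 g := gᴴ J g = J`, `IsSU11 g := IsU11 g ∧ det g = 1`; `‖det g‖ = 1` on `U(1,1)` (`norm_det_eq_one`);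
* **`exists_smul_su11`: every `g ∈ U(1,1)` is `z • s` with `‖z‖ = 1`, `z² = det g` and `s ∈ SU(1,1)`** — the
  `U(1) · SU(1,1)` decomposition (`z` is a square root of `det g`, `s = z⁻¹ • g`);
* the diagonal torus `diagonal ![α, β]` (`‖α‖ = ‖β‖ = 1`) lies in `U(1,1)` (`isU11_diagonal`), and **every torus
  element is `c • diagonal ![u, u⁻¹]` with `‖c‖ = ‖u‖ = 1`** (`exists_central_smul_diagonal`: `c² = α β`,
  `u = α / c`) — the torus is `Z · K` with `Z` the central `U(1)` and `K = T ∩ SU(1,1)` (`isSU11_diagonal_inv`);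
  the fibre of `(c, u) ↦ c • diagonal ![u, u⁻¹]` over `c ≠ 0` is `{±(c, u)}` (`central_smul_diagonal_inj`: the 2-to-1 cover);
* the conjugate torus `h T h⁻¹` (`h ∈ SU(1,1)`) inherits the decomposition (`conj_central_smul`).
The companion module `CompactGroupSurjIntegral` carries the integral identity `∫_T F = ∫_K F` for a `Z`-invariant
integrand along the surjective multiplication `Z × K → T`; these are the objects it is applied to. Nothing here is
about a representation, a test function or a period; that the real `f_v` (the `D_k` coefficient of `U(1,1)`)
restricts to the model's `SU(1,1)` coefficient stays in words (TYPING-CENSUS T7).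
Nothing about (N) or HC_CM; §8(d): NO. Blind lane: Mathlib only; no sorry; axioms ⊆ {propext, Classical.choice, Quot.sound}.
-/

namespace Summit.Ventures.HodgeRepro2.Tier7.Line3.UnitaryOneOneCentre

open Matrix

/-- the hermitian form of signature `(1, 1)`: `J = diag(1, −1)` -/
def J : Matrix (Fin 2) (Fin 2) ℂ := diagonal ![1, -1]

/-- `g ∈ U(1,1)`: `gᴴ J g = J` -/
def IsU11 (g : Matrix (Fin 2) (Fin 2) ℂ) : Prop := gᴴ * J * g = J

/-- `g ∈ SU(1,1)`: in `U(1,1)` with determinant `1` -/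
def IsSU11 (g : Matrix (Fin 2) (Fin 2) ℂ) : Prop := IsU11 g ∧ g.det = 1

/-! ## 1. `U(1,1) = U(1) · SU(1,1)` -/

/-- `det J = −1` -/
theorem det_J : J.det = -1 := by
  unfold J
  rw [det_diagonal]
  simp

/-- `J ≠ 0` as a determinant: `det J ≠ 0` -/
theorem det_J_ne_zero : J.det ≠ 0 := by
  rw [det_J]; norm_num

/-- on `U(1,1)` the determinant has modulus one: `star (det g) * det g = 1`. -/
theorem star_det_mul_det {g : Matrix (Fin 2) (Fin 2) ℂ} (hg : IsU11 g) : star g.det * g.det = 1 := by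
  have h := congrArg Matrix.det hg
  rw [det_mul, det_mul, det_conjTranspose] at h
  have hJ := det_J_ne_zero
  -- `star (det g) * det J * det g = det J`
  have : (star g.det * g.det) * J.det = 1 * J.det := by
    calc (star g.det * g.det) * J.det = star g.det * J.det * g.det := by ring
      _ = J.det := h
      _ = 1 * J.det := (one_mul _).symm
  exact mul_right_cancel₀ hJ this

/-- `‖det g‖ = 1` on `U(1,1)`. -/
theorem norm_det_eq_one {g : Matrix (Fin 2) (Fin 2) ℂ} (hg : IsU11 g) : ‖g.det‖ = 1 := by
  have h := star_det_mul_det hg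
  have h1 : ((Complex.normSq g.det : ℝ) : ℂ) = 1 := by
    rw [Complex.normSq_eq_conj_mul_self, ← Complex.star_def]
    exact h
  have h1' : Complex.normSq g.det = 1 := by exact_mod_cast h1
  have h2 : ‖g.det‖ ^ 2 = 1 := by
    rw [← Complex.normSq_eq_norm_sq]
    exact h1'
  have h0 : 0 ≤ ‖g.det‖ := norm_nonneg _
  nlinarith

/-- a scalar of modulus one preserves the form: `IsU11 (z • g)` for `‖z‖ = 1`. -/
theorem isU11_smul {g : Matrix (Fin 2) (Fin 2) ℂ} (hg : IsU11 g) {z : ℂ} (hz : ‖z‖ = 1) : IsU11 (z • g) := by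
  unfold IsU11 at hg ⊢
  rw [conjTranspose_smul, Matrix.smul_mul, Matrix.mul_smul, Matrix.smul_mul, smul_smul, hg]
  have : z * star z = 1 := by
    rw [mul_comm, Complex.star_def, ← Complex.normSq_eq_conj_mul_self, Complex.normSq_eq_norm_sq, hz]
    norm_num
  rw [this, one_smul]

/-- a square root in `ℂ`: `∃ z, z ^ 2 = w` -/
theorem exists_sq_eq (w : ℂ) : ∃ z : ℂ, z ^ 2 = w :=
  ⟨w ^ (((2 : ℕ) : ℂ)⁻¹), Complex.cpow_nat_inv_pow w two_ne_zero⟩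

/-- **`U(1,1) = U(1) · SU(1,1)`**: every `g ∈ U(1,1)` is `z • s` with `‖z‖ = 1`, `z ^ 2 = det g` and `s ∈ SU(1,1)`. -/
theorem exists_smul_su11 {g : Matrix (Fin 2) (Fin 2) ℂ} (hg : IsU11 g) :
    ∃ z : ℂ, ∃ s : Matrix (Fin 2) (Fin 2) ℂ, ‖z‖ = 1 ∧ z ^ 2 = g.det ∧ IsSU11 s ∧ g = z • s := by
  obtain ⟨z, hz2⟩ := exists_sq_eq g.det
  have hdet := norm_det_eq_one hg
  have hz : ‖z‖ = 1 := by
    have h : ‖z‖ ^ 2 = 1 := by rw [← norm_pow, hz2, hdet]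
    have h0 : 0 ≤ ‖z‖ := norm_nonneg _
    nlinarith
  have hz0 : z ≠ 0 := by
    intro h; rw [h, norm_zero] at hz; exact zero_ne_one hz
  have hzinv : ‖z⁻¹‖ = 1 := by rw [norm_inv, hz, inv_one]
  refine ⟨z, z⁻¹ • g, hz, hz2, ⟨isU11_smul hg hzinv, ?_⟩, ?_⟩
  · rw [det_smul, Fintype.card_fin, inv_pow, ← hz2]
    exact inv_mul_cancel₀ (pow_ne_zero 2 hz0)
  · rw [smul_smul, mul_inv_cancel₀ hz0, one_smul]

/-! ## 2. The diagonal torus `T = Z · K` -/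

/-- a diagonal matrix with unit entries lies in `U(1,1)`. -/
theorem isU11_diagonal {α β : ℂ} (hα : ‖α‖ = 1) (hβ : ‖β‖ = 1) : IsU11 (diagonal ![α, β]) := by
  unfold IsU11 J
  rw [diagonal_conjTranspose, diagonal_mul_diagonal, diagonal_mul_diagonal]
  congr 1
  have hα' : (starRingEnd ℂ) α * α = 1 := by
    rw [← Complex.normSq_eq_conj_mul_self, Complex.normSq_eq_norm_sq, hα]; norm_num
  have hβ' : (starRingEnd ℂ) β * β = 1 := by
    rw [← Complex.normSq_eq_conj_mul_self, Complex.normSq_eq_norm_sq, hβ]; norm_num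
  funext i
  fin_cases i
  · simp [hα']
  · simp [hβ']

/-- `diagonal ![u, u⁻¹]` with `‖u‖ = 1` lies in `SU(1,1)` (the torus `K = T ∩ SU(1,1)`). -/
theorem isSU11_diagonal_inv {u : ℂ} (hu : ‖u‖ = 1) : IsSU11 (diagonal ![u, u⁻¹]) := by
  have hu0 : u ≠ 0 := by intro h; rw [h, norm_zero] at hu; exact zero_ne_one hu
  refine ⟨isU11_diagonal hu (by rw [norm_inv, hu, inv_one]), ?_⟩
  rw [det_diagonal]
  simp [mul_inv_cancel₀ hu0]

/-- **the torus is `Z · K`**: every `diagonal ![α, β]` with `‖α‖ = ‖β‖ = 1` is `c • diagonal ![u, u⁻¹]` with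
`‖c‖ = ‖u‖ = 1` (`c ^ 2 = α β`, `u = α / c`). -/
theorem exists_central_smul_diagonal {α β : ℂ} (hα : ‖α‖ = 1) (hβ : ‖β‖ = 1) :
    ∃ c u : ℂ, ‖c‖ = 1 ∧ ‖u‖ = 1 ∧ diagonal ![α, β] = c • diagonal ![u, u⁻¹] := by
  obtain ⟨c, hc2⟩ := exists_sq_eq (α * β)
  have hc : ‖c‖ = 1 := by
    have h : ‖c‖ ^ 2 = 1 := by rw [← norm_pow, hc2, norm_mul, hα, hβ, one_mul]
    have h0 : 0 ≤ ‖c‖ := norm_nonneg _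
    nlinarith
  have hc0 : c ≠ 0 := by intro h; rw [h, norm_zero] at hc; exact zero_ne_one hc
  have hα0 : α ≠ 0 := by intro h; rw [h, norm_zero] at hα; exact zero_ne_one hα
  refine ⟨c, α / c, hc, by rw [norm_div, hα, hc, div_one], ?_⟩
  have e1 : c * (α / c) = α := mul_div_cancel₀ α hc0
  have e2 : c * (c / α) = β := by
    rw [← mul_div_assoc, ← sq, hc2, mul_div_cancel_left₀ β hα0]
  rw [← diagonal_smul]
  congr 1
  funext i
  fin_cases i
  · simp [e1]
  · simp [e2]

/-- the fibre of `(c, u) ↦ c • diagonal ![u, u⁻¹]` over a non-zero `c` is `{(c, u), (−c, −u)}`: the 2-to-1 cover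
`Z × K → T`. -/
theorem central_smul_diagonal_inj {c u c' u' : ℂ} (hc : c ≠ 0) (hu : u ≠ 0) (hu' : u' ≠ 0)
    (h : c • diagonal ![u, u⁻¹] = c' • diagonal ![u', u'⁻¹]) :
    (c' = c ∧ u' = u) ∨ (c' = -c ∧ u' = -u) := by
  have h00 : c * u = c' * u' := by
    have := congrFun (congrFun h 0) 0
    simpa using this
  have h11 : c * u⁻¹ = c' * u'⁻¹ := by
    have := congrFun (congrFun h 1) 1
    simpa using this
  have hsq : c ^ 2 = c' ^ 2 := by
    have e : (c * u) * (c * u⁻¹) = (c' * u') * (c' * u'⁻¹) := by rw [h00, h11]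
    have e1 : (c * u) * (c * u⁻¹) = c ^ 2 := by
      rw [mul_mul_mul_comm, mul_inv_cancel₀ hu, mul_one, sq]
    have e2 : (c' * u') * (c' * u'⁻¹) = c' ^ 2 := by
      rw [mul_mul_mul_comm, mul_inv_cancel₀ hu', mul_one, sq]
    rw [e1, e2] at e
    exact e
  have hcc : c' = c ∨ c' = -c := by
    have : (c' - c) * (c' + c) = 0 := by linear_combination (-1 : ℂ) * hsq
    rcases mul_eq_zero.1 this with h1 | h1
    · left; linear_combination h1
    · right; linear_combination h1
  rcases hcc with rfl | rfl
  · left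
    exact ⟨rfl, (mul_left_cancel₀ hc h00).symm⟩
  · right
    refine ⟨rfl, ?_⟩
    have : c * (u + u') = 0 := by linear_combination h00
    rcases mul_eq_zero.1 this with h1 | h1
    · exact absurd h1 hc
    · linear_combination h1

/-- the conjugate torus `h T h⁻¹` inherits the decomposition: `h * (c • t) * h⁻¹ = c • (h * t * h⁻¹)`. -/
theorem conj_central_smul (h t : Matrix (Fin 2) (Fin 2) ℂ) (c : ℂ) :
    h * (c • t) * h⁻¹ = c • (h * t * h⁻¹) := by
  rw [Matrix.mul_smul, Matrix.smul_mul]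

end Summit.Ventures.HodgeRepro2.Tier7.Line3.UnitaryOneOneCentre
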